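import Mathlib
import Summits.ValiantsHypothesis.ValiantsHypothesis.Theses.BarrierLever
import Summits.ValiantsHypothesis.ValiantsHypothesis.Theorems.BarrierLeverDefinableEquationsDefs
import Summits.ValiantsHypothesis.ValiantsHypothesis.Theorems.BarrierLeverDefinableEquationsTopEquations
import Summits.ValiantsHypothesis.ValiantsHypothesis.Theorems.BarrierLeverDefinableEquationsRazAnnihilators
import Summits.ValiantsHypothesis.ValiantsHypothesis.Theorems.BarrierLeverDefinableEquationsRazImage

/-!
# Crux `BarrierLever.DefinableEquations` (stmt-ValiantsHypothesis-8745) — the registered stub of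
# line `registered` is EQUIVALENT to the crux (lead c6)

`RazAnn(n, b, a)`: a nonzero level-`a` boolean sum in the top coefficient variables
`topMonomials n` vanishing on the whole image `razPoint n b` of Raz's universal-circuit map;
`TopEq(n, b, a)`: the same vanishing at the top component of every `f ∈ SmallCircuits ℂ n b`.

* `RazAnnihilators.razAnn_of_topEq`: `TopEq(n, 2b+9, a) → RazAnn(n, b, a)` for `n ≥ 64` — every
  Raz point is the top-coefficient vector of `outVal y ∈ SmallCircuits ℂ n (2b+9)`
  (`outVal_mem_smallCircuits`, file `…RazImage.lean`; `RazUniversal.coeff_outVal`).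
* `definableEquations_iff_razAnnihilators` (registered sub-goal):
  `DefinableEquations ↔ ∃ a ∀ b ∃ n₀ ∀ n ≥ n₀, RazAnn(n, b, a)` — `→` by the top-component normal
  form `TopEquations.definableEquations_iff` and `razAnn_of_topEq`; `←` is the landed
  `definableEquations_of_razAnnihilators`.  The infinitely-often forms correspond too
  (`definableEquations_io_iff_razAnnihilators_io`).

So the skeleton's one stub `stub_uniformRazAnnihilators` (Lines/registered.lean) is the crux
itself in normal form — "ONE level `a` such that for every `b`, eventually in `n`, Raz's
degree-`(2n-1)` coefficient map `Γ_{n,b}` on `Sym^n ℂ^n` has a nonzero VNP(2^n)-explicit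
annihilator" (Chatterjee–Tengse 2023 §1.3, open direction 2, uniformly in `b`) — kernel-checked in
both directions.  Pure bookkeeping; no definitions, no facts.
-/

set_option linter.dupNamespace false

noncomputable section

namespace Summit.ValiantsHypothesis.ValiantsHypothesis.Theorems.BarrierLeverDefinableEquations

open MvPolynomial
open Literature.Computability.AlgebraicComplexity Literature.Barriers.ValiantsHypothesis
open scoped BigOperators

namespace RazAnnihilators

/-- **`TopEq(n, 2b+9, a) → RazAnn(n, b, a)`** for `n ≥ 64`: a top equation against
`SmallCircuits ℂ n (2b+9)` vanishes at every Raz point, because `razPoint n b y` is the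
top-coefficient vector of `outVal y ∈ SmallCircuits ℂ n (2b+9)`. [folklore] -/
theorem razAnn_of_topEq {a b n : ℕ} (hn : 64 ≤ n)
    (h : ∃ q : ℕ, q ≤ (Nat.choose (2 * n) n) ^ a ∧
      ∃ H : MvPolynomial (↥(topMonomials n) ⊕ Fin q) ℂ,
        complexity H ≤ (Nat.choose (2 * n) n) ^ a ∧ H.totalDegree ≤ (Nat.choose (2 * n) n) ^ a ∧
        boolSum H ≠ 0 ∧
        ∀ f ∈ SmallCircuits ℂ n (2 * b + 9),
          eval (fun e : topMonomials n => coeff (e : Fin n →₀ ℕ) f) (boolSum H) = 0) :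
    ∃ q : ℕ, q ≤ (Nat.choose (2 * n) n) ^ a ∧
      ∃ H : MvPolynomial (↥(topMonomials n) ⊕ Fin q) ℂ,
        complexity H ≤ (Nat.choose (2 * n) n) ^ a ∧ H.totalDegree ≤ (Nat.choose (2 * n) n) ^ a ∧
        boolSum H ≠ 0 ∧
        ∀ y : RazUniversal.Lab (Fin n) n (razSlots n b) → ℂ, eval (razPoint n b y) (boolSum H) = 0 := by
  obtain ⟨q, hq, H, hHc, hHd, hne, hvan⟩ := h
  refine ⟨q, hq, H, hHc, hHd, hne, fun y => ?_⟩
  have hpt : razPoint n b y =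
      fun e : topMonomials n => coeff (e : Fin n →₀ ℕ) (RazUniversal.outVal y) := by
    funext e
    rw [RazUniversal.coeff_outVal]
    rfl
  rw [hpt]
  exact hvan _ (outVal_mem_smallCircuits b n hn y)

/-- **The crux ⟺ uniform Raz annihilators** (inner form). [folklore] -/
theorem definableEquations_iff :
    Summit.ValiantsHypothesis.ValiantsHypothesis.Theses.BarrierLever.DefinableEquations ↔
      ∃ a : ℕ, ∀ b : ℕ, ∃ n₀ : ℕ, ∀ n ≥ n₀, ∃ q : ℕ, q ≤ (Nat.choose (2 * n) n) ^ a ∧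
        ∃ H : MvPolynomial (↥(topMonomials n) ⊕ Fin q) ℂ,
          complexity H ≤ (Nat.choose (2 * n) n) ^ a ∧ H.totalDegree ≤ (Nat.choose (2 * n) n) ^ a ∧
          boolSum H ≠ 0 ∧
          ∀ y : RazUniversal.Lab (Fin n) n (razSlots n b) → ℂ, eval (razPoint n b y) (boolSum H) = 0 := by
  refine ⟨fun h => ?_, fun h => definableEquations_of_razAnnihilators h⟩
  obtain ⟨a, ha⟩ := TopEquations.definableEquations_iff.1 h
  refine ⟨a, fun b => ?_⟩
  obtain ⟨n₀, hn₀⟩ := ha (2 * b + 9)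
  refine ⟨max n₀ 64, fun n hn => ?_⟩
  exact razAnn_of_topEq (le_trans (le_max_right _ _) hn) (hn₀ n (le_trans (le_max_left _ _) hn))

/-- **`DefEq_io ⟺ RazAnn_io`**: the infinitely-often forms (what the assembly consumes)
correspond as well. [folklore] -/
theorem definableEquations_io_iff_razAnnihilators_io :
    (∃ a : ℕ, ∀ b n₀ : ℕ, ∃ n : ℕ, n₀ ≤ n ∧ ∃ q : ℕ, q ≤ (Nat.choose (2 * n) n) ^ a ∧
      ∃ H : MvPolynomial (↥(degLEMonomials n) ⊕ Fin q) ℂ,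
        complexity H ≤ (Nat.choose (2 * n) n) ^ a ∧ H.totalDegree ≤ (Nat.choose (2 * n) n) ^ a ∧
        boolSum H ≠ 0 ∧
        ∀ f ∈ SmallCircuits ℂ n b, eval (coeffVector (degLEMonomials n) f) (boolSum H) = 0) ↔
    (∃ a : ℕ, ∀ b n₀ : ℕ, ∃ n : ℕ, n₀ ≤ n ∧ ∃ q : ℕ, q ≤ (Nat.choose (2 * n) n) ^ a ∧
      ∃ H : MvPolynomial (↥(topMonomials n) ⊕ Fin q) ℂ,
        complexity H ≤ (Nat.choose (2 * n) n) ^ a ∧ H.totalDegree ≤ (Nat.choose (2 * n) n) ^ a ∧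
        boolSum H ≠ 0 ∧
        ∀ y : RazUniversal.Lab (Fin n) n (razSlots n b) → ℂ, eval (razPoint n b y) (boolSum H) = 0) := by
  refine ⟨fun h => ?_, fun h => io_of_razAnnihilators_io h⟩
  obtain ⟨a, ha⟩ := definableEquations_io_iff_topEquations_io.1 h
  refine ⟨a, fun b n₀ => ?_⟩
  obtain ⟨n, hn, hrest⟩ := ha (2 * b + 9) (max n₀ 64)
  exact ⟨n, le_trans (le_max_left _ _) hn, razAnn_of_topEq (le_trans (le_max_right _ _) hn) hrest⟩

end RazAnnihilators

/-- **Registered sub-goal `definableEquations_iff_razAnnihilators` (verbatim signature).**  The crux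
is equivalent to the registered stub `stub_uniformRazAnnihilators` of line `registered`
(`RazAnnihilators.definableEquations_iff`). [folklore] -/
theorem definableEquations_iff_razAnnihilators : Summit.ValiantsHypothesis.ValiantsHypothesis.Theses.BarrierLever.DefinableEquations ↔ ∃ a : ℕ, ∀ b : ℕ, ∃ n₀ : ℕ, ∀ n ≥ n₀, ∃ q : ℕ, q ≤ (Nat.choose (2 * n) n) ^ a ∧ ∃ H : MvPolynomial (↥(Summit.ValiantsHypothesis.ValiantsHypothesis.Theorems.BarrierLeverDefinableEquations.topMonomials n) ⊕ Fin q) ℂ, Literature.Computability.AlgebraicComplexity.complexity H ≤ (Nat.choose (2 * n) n) ^ a ∧ H.totalDegree ≤ (Nat.choose (2 * n) n) ^ a ∧ Literature.Computability.AlgebraicComplexity.boolSum H ≠ 0 ∧ ∀ y : Literature.Computability.AlgebraicComplexity.RazUniversal.Lab (Fin n) n (Summit.ValiantsHypothesis.ValiantsHypothesis.Theorems.BarrierLeverDefinableEquations.razSlots n b) → ℂ, MvPolynomial.eval (Summit.ValiantsHypothesis.ValiantsHypothesis.Theorems.BarrierLeverDefinableEquations.razPoint n b y) (Literature.Computability.AlgebraicComplexity.boolSum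 H) = 0 :=
  RazAnnihilators.definableEquations_iff

end Summit.ValiantsHypothesis.ValiantsHypothesis.Theorems.BarrierLeverDefinableEquations

end
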